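import Literature.Analysis.ValidatedNumerics.TaylorModelBivariate
import HarnessLib

/-!
# Bivariate Taylor models: reciprocal, square root and logarithm

Trunk T-ANA (Analysis/ValidatedNumerics); namespace `Literature.Analysis.ValidatedNumerics.PolyMP`.
Sequel of `TaylorModelBivariate.lean` (bivariate Taylor models `TMem2 S h k f P` on the box `|ρ| ≤ h, |σ| ≤ k`,
their arithmetic, the range bounds `tupper2 / tlower2 / tabs2` and the intrinsic `exp`).  This file adds the three
remaining intrinsics needed for algebraic–logarithmic integrands (rational functions, square roots, logarithms —
the shape of Feynman-parameter and period integrands), in the Makino–Berz form "split off the constant part `c`,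
expand the intrinsic about `c` in the small quantity `u = (g − c)/c`":

* **reciprocal.** `tinvVerify2 S h k D G Q`: A POSTERIORI validation of ANY candidate model `Q` for `1/g` — from the
  range bound `m ≤ |g|·S` (`tabsLower2`) and the bound `B` of the residual `1 − g·q` in Taylor-model arithmetic,
  `|1/g − q| = |1 − g q|/|g| ≤ (B/S)/(m/S)`, folded into the constant coefficient; accepted iff `0 < m`
  (`tmem2_inv_of_tinvVerify2`).  The in-kernel candidate `tinv2TM S h k D K G` is the geometric series
  `c⁻¹ Σ_{i ≤ K} (−u)^i` of op. cit. (`tmem2_inv_of_tinv2TM`);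
* **square root.** `tsqrtVerify2`: validation of a candidate `Q` for `√g` from `s ≤ q·S` and the residual `g − q²`,
  `|√g − q|·q ≤ |g − q²|` (for Mathlib's total `Real.sqrt` and every real `g`, so no sign condition on `g` is
  needed); the candidate `tsqrt2TM S h k D K fuel G` is `r · Σ_{i ≤ K} binom(1/2, i) u^i` with `r ≈ √c` by Heron's
  iteration rounded to the scale `S` (`heronQ`) — the binomial expansion of the references
  (`tmem2_sqrt_of_tsqrt2TM`);
* **logarithm.** `tlog1p2 S h k D K U` / `tmem2_log1p2`: `log(1 + u)` by the logarithmic series with the remainder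
  `|u|^{K+1}/(1 − |u|)` (`|u|·S ≤ tabs2 < S`), and `tlog2TM S h k D K Kl G` / `tmem2_log_of_tlog2TM`:
  `log g = log c + log(1 + (g − c)/c)`, `log c ∈ MI.logPos` — the bivariate port of `TaylorModelLog.tlogTM`.

Every model is returned with its acceptance flag so that a certificate checker can conjoin it; positivity of `g`
(for `log`) and `g ≠ 0` (for the reciprocal) on the box FOLLOW from acceptance.  The remainder of the reciprocal
and of the square root is obtained from the residual rather than from the Lagrange form of the references: this
keeps the kernel computation to one extra truncated product and makes soundness independent of how the candidate
was produced.  Problem-independent plumbing for kernel-checked double-integral certificates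
(`TaylorModelIntegralCert2DElem.lean`); no facts, no axioms; all data computable over `ℤ`.

## References

* K. Makino, M. Berz, *Taylor models and other validated functional inclusion methods*, Int. J. Pure Appl.
  Math. 4 (2003) 379–456: Definition 3 (intrinsic functions on Taylor models by the addition theorems: the constant
  part split off, the intrinsic expanded about it). [cite: MakinoBerz2003, Definition 3]
* M. Joldeş, *Rigorous Polynomial Approximations and Applications*, PhD thesis, ENS Lyon (2011): Algorithm 2.2.4
  (Taylor model of the reciprocal `x ↦ 1/x`, thesis p. 56), Algorithm 2.2.8 `TMComp` (composition with a basic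
  function about the constant coefficient, p. 60), Algorithm 2.2.9 `TMBaseDiv` (`f/g = f · (1/g)`, p. 61),
  Section 2.2.1 (basic functions by Taylor series with remainder). [cite: Joldes2011, Algorithm 2.2.4]
  [cite: Joldes2011, Algorithm 2.2.8] [cite: Joldes2011, Section 2.2.1]
* I. Eble, *Über Taylor-Modelle*, Dissertation, Universität Karlsruhe (2007), §2.2.2 "Standardfunktionen",
  thesis pp. 32–34: the division (2.34) and the expansions of `√`, `1/√`, `log` about the constant part `c` after
  Berz–Makino. [cite: Eble2007, Sect. 2.2.2]
* The logarithmic series with remainder (Mathlib `Real.abs_log_sub_add_sum_range_le`). [folklore]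
-/

namespace Literature.Analysis.ValidatedNumerics

namespace PolyMP

open Literature.Analysis.ValidatedNumerics.NumericsMP
open Literature.Analysis.ValidatedNumerics.ExpPoly (Poly)
open Literature.Analysis.ValidatedNumerics.ExpPoly

/-! ### The small quantity `u = (g − c)/c` -/

/-- The relative deviation from the constant part: `u = c⁻¹ · (G − c)` with `c = mid00 S G` the rational midpoint of
the constant coefficient (the argument of every intrinsic expansion below). [cite: MakinoBerz2003, Definition 3] -/
def trelDev2 (S : ℕ) (G : IPoly2) : IPoly2 :=
  tsmulI2 S (ofRat S (mid00 S G)⁻¹) (tsub2 G (tconst2 (ofRat S (mid00 S G))))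

/-- [cite: MakinoBerz2003, Definition 3] -/
theorem tmem2_relDev {S : ℕ} (hS : 0 < S) {h k : ℚ} {g : ℝ → ℝ → ℝ} {G : IPoly2} (hg : TMem2 S h k g G) :
    TMem2 S h k (fun ρ σ => (((mid00 S G)⁻¹ : ℚ) : ℝ) * (g ρ σ - ((mid00 S G : ℚ) : ℝ))) (trelDev2 S G) :=
  tmem2_smulI hS (mem_ofRat S _) (tmem2_sub hg (tmem2_const (mem_ofRat S _)))

/-! ### The reciprocal: a posteriori validation of a candidate -/

/-- Scaled lower bound of `|f|` on the box: `max (tlower2, −tupper2)`. [cite: Joldes2011, Algorithm 2.2.4] -/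
def tabsLower2 (S : ℕ) (h k : ℚ) (P : IPoly2) : ℤ := max (tlower2 S h k P) (-tupper2 S h k P)

/-- [cite: Joldes2011, Algorithm 2.2.4] -/
theorem tabsLower2_le {S : ℕ} {h k : ℚ} (h0 : 0 ≤ h) (k0 : 0 ≤ k) {f : ℝ → ℝ → ℝ} {P : IPoly2}
    (hf : TMem2 S h k f P) {ρ σ : ℝ} (hρ : |ρ| ≤ h) (hσ : |σ| ≤ k) :
    (tabsLower2 S h k P : ℝ) ≤ |f ρ σ| * S := by
  have h1 := le_tupper2 h0 k0 hf hρ hσ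
  have h2 := tlower2_le h0 k0 hf hρ hσ
  simp only [tabsLower2, Int.cast_max, Int.cast_neg]
  have hS0 : (0 : ℝ) ≤ S := by positivity
  rcases le_total 0 (f ρ σ) with hp | hn
  · rw [abs_of_nonneg hp]
    have : 0 ≤ f ρ σ * S := mul_nonneg hp hS0
    exact max_le h2 (by linarith)
  · rw [abs_of_nonpos hn]
    have : f ρ σ * S ≤ 0 := mul_nonpos_of_nonpos_of_nonneg hn hS0
    exact max_le (by linarith) (by linarith)

/-- Passing from the real bound `B·S/m` to the integer `⌈B·S/m⌉` used as widening amount. [folklore] -/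
private theorem le_ceil_scaled_bv {x : ℝ} {S : ℕ} {B m : ℤ} (hx : x ≤ (B : ℝ) * S / m) :
    x ≤ ((⌈((B : ℚ) * S) / (m : ℚ)⌉ : ℤ) : ℝ) := by
  refine hx.trans ?_
  have h := (Int.le_ceil (((B : ℚ) * S) / (m : ℚ)))
  have h' : ((((B : ℚ) * S) / (m : ℚ) : ℚ) : ℝ) ≤ ((⌈((B : ℚ) * S) / (m : ℚ)⌉ : ℤ) : ℝ) := by exact_mod_cast h
  push_cast at h'
  exact h'

/-- The algebra of the a posteriori bound for the reciprocal: `|1/g − q|·S ≤ B·S/m` from `m ≤ |g|·S`, `0 < m` and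
`|1 − g q|·S ≤ B`. [folklore] -/
private theorem inv_resid_bound_bv {g q S m B : ℝ} (hS : 0 < S) (hm : 0 < m) (hgm : m ≤ |g| * S)
    (hRB : |1 - g * q| * S ≤ B) : |g⁻¹ - q| * S ≤ B * S / m := by
  have hgpos : 0 < |g| := by
    rcases (abs_nonneg g).eq_or_lt with h | h
    · rw [← h, zero_mul] at hgm; linarith
    · exact h
  have hg0 : g ≠ 0 := abs_pos.mp hgpos
  have hB0 : 0 ≤ B := le_trans (mul_nonneg (abs_nonneg _) hS.le) hRB
  have e1 : g⁻¹ - q = (1 - g * q) / g := by field_simp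
  rw [e1, abs_div, div_mul_eq_mul_div, div_le_iff₀ hgpos, div_mul_eq_mul_div, le_div_iff₀ hm]
  have h3 : B * m ≤ B * (|g| * S) := mul_le_mul_of_nonneg_left hgm hB0
  have h4 : |1 - g * q| * S * m ≤ B * m := mul_le_mul_of_nonneg_right hRB hm.le
  nlinarith

/-- **A posteriori validation of a reciprocal candidate.**  Input: models `G` of `g` and `Q` of a candidate `q`;
output: `Q` with its constant coefficient widened by `⌈B·S/m⌉`, `m = tabsLower2 G` (so `|g| ≥ m/S`), `B` the range
bound of the residual `1 − G·Q` in truncated Taylor-model arithmetic; accepted iff `0 < m`.  (The references bound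
the remainder of the series of `1/x` in Lagrange form; here the bound comes from the residual, which validates any
candidate.) [cite: Joldes2011, Algorithm 2.2.4] [cite: MakinoBerz2003, Definition 3] -/
def tinvVerify2 (S : ℕ) (h k : ℚ) (D : ℕ) (G Q : IPoly2) : IPoly2 × Bool :=
  let m : ℤ := tabsLower2 S h k G
  let B : ℤ := tabs2 S h k (tsub2 (tconst2 (MI.ofInt S 1)) (tmul2 S h k D G Q))
  (widen00 Q ⌈((B : ℚ) * S) / (m : ℚ)⌉, decide (0 < m))

/-- **Soundness of `tinvVerify2`**: if `G` encloses `g`, `Q` encloses some `q` and the flag is raised, the returned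
model encloses `(ρ, σ) ↦ (g ρ σ)⁻¹` (and `g ≠ 0` on the box). [cite: Joldes2011, Algorithm 2.2.4]
[cite: MakinoBerz2003, Definition 3] -/
theorem tmem2_inv_of_tinvVerify2 {S : ℕ} (hS : 0 < S) {h k : ℚ} (h0 : 0 ≤ h) (k0 : 0 ≤ k) {D : ℕ}
    {g q : ℝ → ℝ → ℝ} {G Q : IPoly2} (hg : TMem2 S h k g G) (hq : TMem2 S h k q Q)
    (hok : (tinvVerify2 S h k D G Q).2 = true) :
    TMem2 S h k (fun ρ σ => (g ρ σ)⁻¹) (tinvVerify2 S h k D G Q).1 := by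
  unfold tinvVerify2 at hok ⊢
  simp only [decide_eq_true_eq] at hok ⊢
  intro ρ σ hρ hσ
  have hSr : (0 : ℝ) < S := by exact_mod_cast hS
  have hgm := tabsLower2_le h0 k0 hg hρ hσ
  have hmR : (0 : ℝ) < (tabsLower2 S h k G : ℤ) := by exact_mod_cast hok
  have h1 : TMem2 S h k (fun _ _ => (1 : ℝ)) (tconst2 (MI.ofInt S 1)) := by
    simpa using tmem2_const (S := S) (h := h) (k := k) (x := (1 : ℝ)) (by simpa using MI.mem_ofInt S 1)
  have hres : TMem2 S h k (fun ρ σ => 1 - g ρ σ * q ρ σ) (tsub2 (tconst2 (MI.ofInt S 1)) (tmul2 S h k D G Q)) :=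
    tmem2_sub h1 (tmem2_mul hS h0 k0 D hg hq)
  have hRB := abs_le_tabs2 h0 k0 hres hρ hσ
  have hbound := inv_resid_bound_bv hSr hmR hgm hRB
  have hδ := le_ceil_scaled_bv hbound
  obtain ⟨p, hp, ev⟩ := hq ρ σ hρ hσ
  obtain ⟨p', hp', ev'⟩ := exists_widen00 hp hδ ρ σ
  exact ⟨p', hp', by rw [ev', ← ev]; ring⟩

/-- Coefficients `(−1)^i`, `i ≤ K`, of the geometric series `1/(1+u) = Σ (−u)^i`. [cite: Joldes2011, Algorithm 2.2.4] -/
def geomCoeffs (K : ℕ) : List ℚ := (List.range (K + 1)).map fun i : ℕ => (-1 : ℚ) ^ i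

/-- **The bivariate Taylor model of `1/g`** with its acceptance flag: candidate `c⁻¹ · Σ_{i ≤ K} (−u)^i`,
`u = (g − c)/c`, `c = mid00 S G`, validated by `tinvVerify2`. [cite: Joldes2011, Algorithm 2.2.4]
[cite: MakinoBerz2003, Definition 3] [cite: Eble2007, Sect. 2.2.2] -/
def tinv2TM (S : ℕ) (h k : ℚ) (D K : ℕ) (G : IPoly2) : IPoly2 × Bool :=
  tinvVerify2 S h k D G (tsmulI2 S (ofRat S (mid00 S G)⁻¹) (thorner2 S h k D (geomCoeffs K) (trelDev2 S G)))

/-- **Soundness of `tinv2TM`.** [cite: Joldes2011, Algorithm 2.2.4] [cite: MakinoBerz2003, Definition 3] -/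
theorem tmem2_inv_of_tinv2TM {S : ℕ} (hS : 0 < S) {h k : ℚ} (h0 : 0 ≤ h) (k0 : 0 ≤ k) {D K : ℕ}
    {g : ℝ → ℝ → ℝ} {G : IPoly2} (hg : TMem2 S h k g G) (hok : (tinv2TM S h k D K G).2 = true) :
    TMem2 S h k (fun ρ σ => (g ρ σ)⁻¹) (tinv2TM S h k D K G).1 := by
  have hq := tmem2_smulI hS (h := h) (k := k) (mem_ofRat S (mid00 S G)⁻¹)
    (tmem2_horner hS h0 k0 D (tmem2_relDev hS hg) (geomCoeffs K))
  exact tmem2_inv_of_tinvVerify2 hS h0 k0 hg hq hok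

/-! ### The square root: a posteriori validation of a candidate -/

/-- `|√g − q|·q ≤ |g − q²|` for `0 < q` and every real `g` (`Real.sqrt g = 0` for `g ≤ 0`). [folklore] -/
private theorem abs_sqrt_sub_mul_le_bv {g q : ℝ} (hq : 0 < q) : |Real.sqrt g - q| * q ≤ |g - q * q| := by
  rcases le_or_gt 0 g with hg | hg
  · have hsq : Real.sqrt g * Real.sqrt g = g := Real.mul_self_sqrt hg
    have hsum : 0 < Real.sqrt g + q := by positivity
    have e1 : Real.sqrt g - q = (g - q * q) / (Real.sqrt g + q) := by
      rw [eq_div_iff hsum.ne']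
      linear_combination hsq
    rw [e1, abs_div, abs_of_pos hsum, div_mul_eq_mul_div, div_le_iff₀ hsum]
    exact mul_le_mul_of_nonneg_left (by linarith [Real.sqrt_nonneg g]) (abs_nonneg _)
  · rw [Real.sqrt_eq_zero'.mpr hg.le, zero_sub, abs_neg, abs_of_pos hq,
      abs_of_nonpos (by nlinarith : g - q * q ≤ 0)]
    nlinarith

/-- The algebra of the a posteriori bound for the square root: `|√g − q|·S ≤ B·S/s` from `0 < s ≤ q·S` and
`|g − q²|·S ≤ B`. [folklore] -/
private theorem sqrt_resid_bound_bv {g q S s B : ℝ} (hS : 0 < S) (hs : 0 < s) (hqs : s ≤ q * S)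
    (hRB : |g - q * q| * S ≤ B) : |Real.sqrt g - q| * S ≤ B * S / s := by
  have hq : 0 < q := by
    rcases lt_or_ge 0 q with hq | hq
    · exact hq
    · have : q * S ≤ 0 := mul_nonpos_of_nonpos_of_nonneg hq hS.le
      linarith
  have h1 := abs_sqrt_sub_mul_le_bv (g := g) hq
  have h4 : |Real.sqrt g - q| * s ≤ B := by
    have h2 : |Real.sqrt g - q| * s ≤ |Real.sqrt g - q| * (q * S) := mul_le_mul_of_nonneg_left hqs (abs_nonneg _)
    have h3 : |Real.sqrt g - q| * q * S ≤ |g - q * q| * S := mul_le_mul_of_nonneg_right h1 hS.le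
    nlinarith
  rw [le_div_iff₀ hs]
  calc |Real.sqrt g - q| * S * s = (|Real.sqrt g - q| * s) * S := by ring
    _ ≤ B * S := mul_le_mul_of_nonneg_right h4 hS.le

/-- **A posteriori validation of a square-root candidate.**  Input: models `G` of `g` and `Q` of a candidate `q`;
output: `Q` widened by `⌈B·S/s⌉` in its constant coefficient, `s = tlower2 Q` (so `q ≥ s/S`), `B` the range bound
of the residual `G − Q·Q`; accepted iff `0 < s`.  No sign test on `G` is needed (`|√g − q|·q ≤ |g − q²|` holds for
every real `g`). [cite: Eble2007, Sect. 2.2.2] [cite: MakinoBerz2003, Definition 3] -/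
def tsqrtVerify2 (S : ℕ) (h k : ℚ) (D : ℕ) (G Q : IPoly2) : IPoly2 × Bool :=
  let s : ℤ := tlower2 S h k Q
  let B : ℤ := tabs2 S h k (tsub2 G (tmul2 S h k D Q Q))
  (widen00 Q ⌈((B : ℚ) * S) / (s : ℚ)⌉, decide (0 < s))

/-- **Soundness of `tsqrtVerify2`**: if `G` encloses `g`, `Q` encloses some `q` and the flag is raised, the
returned model encloses `(ρ, σ) ↦ √(g ρ σ)`. [cite: Eble2007, Sect. 2.2.2] [cite: MakinoBerz2003, Definition 3] -/
theorem tmem2_sqrt_of_tsqrtVerify2 {S : ℕ} (hS : 0 < S) {h k : ℚ} (h0 : 0 ≤ h) (k0 : 0 ≤ k) {D : ℕ}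
    {g q : ℝ → ℝ → ℝ} {G Q : IPoly2} (hg : TMem2 S h k g G) (hq : TMem2 S h k q Q)
    (hok : (tsqrtVerify2 S h k D G Q).2 = true) :
    TMem2 S h k (fun ρ σ => Real.sqrt (g ρ σ)) (tsqrtVerify2 S h k D G Q).1 := by
  unfold tsqrtVerify2 at hok ⊢
  simp only [decide_eq_true_eq] at hok ⊢
  intro ρ σ hρ hσ
  have hSr : (0 : ℝ) < S := by exact_mod_cast hS
  have hqs := tlower2_le h0 k0 hq hρ hσ
  have hsR : (0 : ℝ) < (tlower2 S h k Q : ℤ) := by exact_mod_cast hok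
  have hres : TMem2 S h k (fun ρ σ => g ρ σ - q ρ σ * q ρ σ) (tsub2 G (tmul2 S h k D Q Q)) :=
    tmem2_sub hg (tmem2_mul hS h0 k0 D hq hq)
  have hRB := abs_le_tabs2 h0 k0 hres hρ hσ
  have hbound := sqrt_resid_bound_bv hSr hsR hqs hRB
  have hδ := le_ceil_scaled_bv hbound
  obtain ⟨p, hp, ev⟩ := hq ρ σ hρ hσ
  obtain ⟨p', hp', ev'⟩ := exists_widen00 hp hδ ρ σ
  exact ⟨p', hp', by rw [ev', ← ev]; ring⟩

/-- The generalised binomial coefficients `binom(1/2, i)`: `1, 1/2, −1/8, 1/16, …`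
(`b₀ = 1`, `b_{i+1} = b_i · (1/2 − i)/(i + 1)`). [cite: Eble2007, Sect. 2.2.2] -/
def binomHalf : ℕ → ℚ
  | 0 => 1
  | i + 1 => binomHalf i * ((1 : ℚ) / 2 - i) / (i + 1)

/-- The coefficient list of `√(1+u) = Σ binom(1/2, i) u^i` up to degree `K`. [cite: Eble2007, Sect. 2.2.2] -/
def binomHalfCoeffs (K : ℕ) : List ℚ := (List.range (K + 1)).map binomHalf

/-- One Heron step `x ↦ (x + c/x)/2`, rounded up to the scale `S`. [cite: Eble2007, Sect. 2.2.2] -/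
def heronStep (S : ℕ) (c x : ℚ) : ℚ := ((⌈((x + c / x) / 2) * (S : ℚ)⌉ : ℤ) : ℚ) / (S : ℚ)

/-- A rational approximation of `√c` (the value of the candidate at the expansion point): `fuel` Heron steps from
`(1 + c)/2 ≥ √c`, each rounded to the scale `S`.  Only a candidate — accuracy is certified a posteriori by
`tsqrtVerify2`. [cite: Eble2007, Sect. 2.2.2] -/
def heronQ (S : ℕ) (c : ℚ) : ℕ → ℚ
  | 0 => (1 + c) / 2
  | n + 1 => heronStep S c (heronQ S c n)

/-- **The bivariate Taylor model of `√g`** with its acceptance flag: candidate `r · Σ_{i ≤ K} binom(1/2, i) u^i`,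
`u = (g − c)/c`, `c = mid00 S G`, `r = heronQ S c fuel ≈ √c`, validated by `tsqrtVerify2` — the expansion
`√y = √c · (1 + u)^{1/2}` of the references. [cite: Eble2007, Sect. 2.2.2] [cite: MakinoBerz2003, Definition 3] -/
def tsqrt2TM (S : ℕ) (h k : ℚ) (D K fuel : ℕ) (G : IPoly2) : IPoly2 × Bool :=
  tsqrtVerify2 S h k D G
    (tsmulI2 S (ofRat S (heronQ S (mid00 S G) fuel)) (thorner2 S h k D (binomHalfCoeffs K) (trelDev2 S G)))

/-- **Soundness of `tsqrt2TM`.** [cite: Eble2007, Sect. 2.2.2] [cite: MakinoBerz2003, Definition 3] -/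
theorem tmem2_sqrt_of_tsqrt2TM {S : ℕ} (hS : 0 < S) {h k : ℚ} (h0 : 0 ≤ h) (k0 : 0 ≤ k) {D K fuel : ℕ}
    {g : ℝ → ℝ → ℝ} {G : IPoly2} (hg : TMem2 S h k g G) (hok : (tsqrt2TM S h k D K fuel G).2 = true) :
    TMem2 S h k (fun ρ σ => Real.sqrt (g ρ σ)) (tsqrt2TM S h k D K fuel G).1 := by
  have hq := tmem2_smulI hS (h := h) (k := k) (mem_ofRat S (heronQ S (mid00 S G) fuel))
    (tmem2_horner hS h0 k0 D (tmem2_relDev hS hg) (binomHalfCoeffs K))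
  exact tmem2_sqrt_of_tsqrtVerify2 hS h0 k0 hg hq hok

/-! ### The logarithm -/

/-- **The logarithmic series with remainder**: for `|u| < 1`,
`|log(1+u) − Σ_{k ≤ K} c_k u^k| ≤ |u|^{K+1}/(1 − |u|)` (`c = log1pCoeffs K`). [folklore] -/
private theorem abs_log_one_add_sub_eval_le_bv {u : ℝ} (hu : |u| < 1) (K : ℕ) :
    |Real.log (1 + u) - Poly.eval (log1pCoeffs K) u| ≤ |u| ^ (K + 1) / (1 - |u|) := by
  have h := Real.abs_log_sub_add_sum_range_le (x := -u) (by rwa [abs_neg]) K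
  rw [abs_neg, sub_neg_eq_add] at h
  have hs : Poly.eval (log1pCoeffs K) u = -∑ i ∈ Finset.range K, (-u) ^ (i + 1) / (i + 1) := by
    rw [log1pCoeffs, poly_eval_map_range, Finset.sum_range_succ', ← Finset.sum_neg_distrib]
    simp only [Nat.cast_zero, pow_zero, mul_one]
    push_cast
    simp only [pow_one, div_zero, add_zero]
    refine Finset.sum_congr rfl fun k _ => ?_
    rw [neg_pow]
    ring
  rw [hs, sub_neg_eq_add, add_comm]
  exact h

/-- The bivariate Taylor model of `(ρ, σ) ↦ log(1 + u(ρ, σ))`: Horner on `log1pCoeffs K` in truncated bivariate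
Taylor-model arithmetic plus the remainder `tlog1pRem S (tabs2 U) K` in the constant coefficient.
[cite: Joldes2011, Section 2.2.1] [cite: MakinoBerz2003, Definition 3] -/
def tlog1p2 (S : ℕ) (h k : ℚ) (D K : ℕ) (U : IPoly2) : IPoly2 :=
  widen00 (thorner2 S h k D (log1pCoeffs K) U) (tlog1pRem S (tabs2 S h k U) K)

/-- **Soundness of `tlog1p2`** (`|u|·S ≤ tabs2 S h k U < S` certifies `|u| < 1`). [cite: Joldes2011, Section 2.2.1]
[cite: MakinoBerz2003, Definition 3] -/
theorem tmem2_log1p2 {S : ℕ} (hS : 0 < S) {h k : ℚ} (h0 : 0 ≤ h) (k0 : 0 ≤ k) (D K : ℕ) {u : ℝ → ℝ → ℝ}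
    {U : IPoly2} (hu : TMem2 S h k u U) (hB : tabs2 S h k U < S) :
    TMem2 S h k (fun ρ σ => Real.log (1 + u ρ σ)) (tlog1p2 S h k D K U) := by
  intro ρ σ hρ hσ
  obtain ⟨p, hp, hev⟩ := tmem2_horner hS h0 k0 D hu (log1pCoeffs K) ρ σ hρ hσ
  have hSr : (0 : ℝ) < S := by exact_mod_cast hS
  have habs := abs_le_tabs2 h0 k0 hu hρ hσ
  have hB1 : ((tabs2 S h k U : ℤ) : ℝ) / S < 1 := by
    rw [div_lt_one hSr]; exact_mod_cast hB
  have huB : |u ρ σ| ≤ ((tabs2 S h k U : ℤ) : ℝ) / S := by rw [le_div_iff₀ hSr]; exact habs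
  have hu1 : |u ρ σ| < 1 := lt_of_le_of_lt huB hB1
  have hB0 : 0 ≤ ((tabs2 S h k U : ℤ) : ℝ) / S := (abs_nonneg _).trans huB
  have hδle : |Real.log (1 + u ρ σ) - Poly.eval (log1pCoeffs K) (u ρ σ)| * S ≤
      (tlog1pRem S (tabs2 S h k U) K : ℝ) := by
    have h1 := abs_log_one_add_sub_eval_le_bv hu1 K
    have hnum : |u ρ σ| ^ (K + 1) ≤ (((tabs2 S h k U : ℤ) : ℝ) / S) ^ (K + 1) :=
      pow_le_pow_left₀ (abs_nonneg _) huB _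
    have h2 : |u ρ σ| ^ (K + 1) / (1 - |u ρ σ|) ≤
        (((tabs2 S h k U : ℤ) : ℝ) / S) ^ (K + 1) / (1 - ((tabs2 S h k U : ℤ) : ℝ) / S) :=
      div_le_div₀ (pow_nonneg hB0 _) hnum (by linarith) (by linarith)
    have h3 := h1.trans h2
    have h4 : ((S : ℚ) * (((((tabs2 S h k U : ℤ) : ℚ) / S) ^ (K + 1)) / (1 - ((tabs2 S h k U : ℤ) : ℚ) / S)) : ℝ) ≤
        (tlog1pRem S (tabs2 S h k U) K : ℝ) := by
      unfold tlog1pRem; exact_mod_cast Int.le_ceil _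
    refine le_trans ?_ h4
    push_cast
    rw [mul_comm ((S : ℕ) : ℝ)]
    exact mul_le_mul_of_nonneg_right h3 hSr.le
  obtain ⟨q, hq, hev2⟩ := exists_widen00 hp hδle ρ σ
  exact ⟨q, hq, by rw [hev2, ← hev]; ring⟩

/-- **The bivariate Taylor model of `log ∘ g`** with its acceptance flag: `c = mid00 S G`, `u = (g − c)/c`,
`log g = log c + log(1 + u)`, `log c ∈ MI.logPos S Kl (ofRat S c)` (refused unless `c > 0` is certified),
`|u|·S ≤ tabs2 < S`. [cite: Joldes2011, Algorithm 2.2.8] [cite: MakinoBerz2003, Definition 3]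
[cite: Eble2007, Sect. 2.2.2] -/
def tlog2TM (S : ℕ) (h k : ℚ) (D K Kl : ℕ) (G : IPoly2) : IPoly2 × Bool :=
  match MI.logPos S Kl (ofRat S (mid00 S G)) with
  | none => ([], false)
  | some L => (tadd2 (tconst2 L) (tlog1p2 S h k D K (trelDev2 S G)), decide (tabs2 S h k (trelDev2 S G) < S))

/-- **Soundness of `tlog2TM`**: if `G` encloses `g` on the box and the flag is raised, the returned model encloses
`(ρ, σ) ↦ log (g ρ σ)` (in particular `g > 0` on the box). [cite: Joldes2011, Algorithm 2.2.8]
[cite: MakinoBerz2003, Definition 3] -/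
theorem tmem2_log_of_tlog2TM {S : ℕ} (hS : 0 < S) {h k : ℚ} (h0 : 0 ≤ h) (k0 : 0 ≤ k) {D K Kl : ℕ}
    {g : ℝ → ℝ → ℝ} {G : IPoly2} (hg : TMem2 S h k g G) (hok : (tlog2TM S h k D K Kl G).2 = true) :
    TMem2 S h k (fun ρ σ => Real.log (g ρ σ)) (tlog2TM S h k D K Kl G).1 := by
  unfold tlog2TM at hok ⊢
  rcases hL : MI.logPos S Kl (ofRat S (mid00 S G)) with _ | L
  · simp only [hL] at hok; exact absurd hok Bool.false_ne_true
  · simp only [hL, decide_eq_true_eq] at hok ⊢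
    obtain ⟨hc0, hlogc⟩ := MI.mem_logPos hS hL (mem_ofRat S (mid00 S G))
    have hU := tmem2_relDev hS hg
    have hsum := tmem2_add (tmem2_const (h := h) (k := k) hlogc) (tmem2_log1p2 hS h0 k0 D K hU hok)
    intro ρ σ hρ hσ
    obtain ⟨p, hp, hev⟩ := hsum ρ σ hρ hσ
    refine ⟨p, hp, ?_⟩
    rw [← hev]
    have hSr : (0 : ℝ) < S := by exact_mod_cast hS
    have habs := abs_le_tabs2 h0 k0 hU hρ hσ
    have hlt : (tabs2 S h k (trelDev2 S G) : ℝ) < S := by exact_mod_cast hok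
    have hu1 : |(((mid00 S G)⁻¹ : ℚ) : ℝ) * (g ρ σ - ((mid00 S G : ℚ) : ℝ))| < 1 := by
      nlinarith [abs_nonneg ((((mid00 S G)⁻¹ : ℚ) : ℝ) * (g ρ σ - ((mid00 S G : ℚ) : ℝ)))]
    have hpos : 0 < 1 + (((mid00 S G)⁻¹ : ℚ) : ℝ) * (g ρ σ - ((mid00 S G : ℚ) : ℝ)) := by
      have := (abs_lt.1 hu1).1; linarith
    have hc0' : ((mid00 S G : ℚ) : ℝ) ≠ 0 := hc0.ne'
    have e : Real.log (g ρ σ) = Real.log ((mid00 S G : ℚ) : ℝ) +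
        Real.log (1 + (((mid00 S G)⁻¹ : ℚ) : ℝ) * (g ρ σ - ((mid00 S G : ℚ) : ℝ))) := by
      rw [← Real.log_mul hc0' hpos.ne']
      congr 1
      push_cast
      field_simp
      ring
    exact e

end PolyMP

end Literature.Analysis.ValidatedNumerics
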